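import Summits.Ventures.PercRepro.RankDistWindowMiddle

/-!
# PercRepro — WINDOW FAMILIES, THE MIDDLE REGIME IS UNIMODAL: the boundary counts are binomials, the binomials are
log-concave, so a decrease of `π(u) = #rFam u / C(n, u)` propagates, and `π(u) ≥ min(π(a), π(b))` on `[a, b]`
(p9, gen 22)

`RankDistWindowMiddle` gives the exact edge count `#rFam u · (n − u) + q₂·Bq(u + 1) = #rFam (u + 1) · (u + 1) +
q₂·Bp(u)` between the one-sided families of consecutive sizes. Here: `Bp(u) = C(|L|, u − p₂)·C(|R|, p₂)`,
`Bq(u + 1) = C(|L|, u + 1 − q₂)·C(|R|, q₂)` (`bpCount_eq`, `bqCount_eq`); the log-concavity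
`C(m, x)·C(m, x + d + 1) ≤ C(m, x + 1)·C(m, x + d)` (`choose_mul_choose_le_choose_mul_choose_of_lt`) makes
`Bp(u)/Bq(u + 1)` non-decreasing, so `Bq(u + 1) < Bp(u)` propagates to `u + 1` (`bq_lt_bp_succ`); in the
probability `π(u) = #rFam u / C(n, u)` (`piR`) the exact edge count reads `π(u) ≤ π(u + 1) ⟺ Bp(u) ≤ Bq(u + 1)`
(`piR_le_succ_iff`, `piR_succ_le_iff`, through `C(n, u + 1)(u + 1) = C(n, u)(n − u)`), so `π` is non-decreasing
while `Bp ≤ Bq` and non-increasing from the first decrease on (`piR_le_of_forall_bp_le_bq`,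
`piR_le_of_forall_bq_lt_bp`): **`min(π(a), π(b)) ≤ π(u)` for `p₂ ≤ a ≤ u ≤ b ≤ min(n, |L| + q₂)`**
(`piR_ge_min_of_middle`). The assembly with (R1)–(R2) of `RankDistWindowSets` into the restricted Vandermonde
inequality is `RankDistRestrictedVandermonde`. Nothing here moves any window of the crux.
-/

namespace PercRepro.RankDist

open Finset

variable {α : Type} [DecidableEq α]

/-- The boundary count `Bp(u)` is a product of binomials: `C(|L|, u − p₂)·C(|R|, p₂)` (`q₂ ≤ p₂ ≤ u`). -/
lemma bpCount_eq {L R : Finset α} (hLR : Disjoint L R) {q₂ p₂ u : ℕ} (hqp : q₂ ≤ p₂) (hpu : p₂ ≤ u) :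
    bpCount L R q₂ p₂ u = L.card.choose (u - p₂) * R.card.choose p₂ := by
  unfold bpCount
  rw [← card_filter_card_inter_eq hLR hpu]
  congr 1
  ext X
  rw [mem_filter, mem_filter, mem_rFam, mem_powersetCard]
  constructor
  · rintro ⟨⟨h1, h2, -, -⟩, h5⟩
    exact ⟨⟨h1, h2⟩, h5⟩
  · rintro ⟨⟨h1, h2⟩, h5⟩
    exact ⟨⟨h1, h2, by omega, by omega⟩, h5⟩

/-- The boundary count `Bq(u + 1)` is a product of binomials: `C(|L|, u + 1 − q₂)·C(|R|, q₂)`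
(`q₂ ≤ p₂`, `q₂ ≤ u + 1`). -/
lemma bqCount_eq {L R : Finset α} (hLR : Disjoint L R) {q₂ p₂ u : ℕ} (hqp : q₂ ≤ p₂) (hqu : q₂ ≤ u + 1) :
    bqCount L R q₂ p₂ u = L.card.choose (u + 1 - q₂) * R.card.choose q₂ := by
  unfold bqCount
  rw [← card_filter_card_inter_eq hLR hqu]
  congr 1
  ext X
  rw [mem_filter, mem_filter, mem_rFam, mem_powersetCard]
  constructor
  · rintro ⟨⟨h1, h2, -, -⟩, h5⟩
    exact ⟨⟨h1, h2⟩, h5⟩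
  · rintro ⟨⟨h1, h2⟩, h5⟩
    exact ⟨⟨h1, h2, by omega, by omega⟩, h5⟩

/-! ## Log-concavity of the binomials and the propagation of a decrease -/

/-- **Log-concavity of the binomial coefficients**: `C(m, x)·C(m, x + d + 1) ≤ C(m, x + 1)·C(m, x + d)`. -/
lemma choose_mul_choose_le_choose_mul_choose_of_lt (m x d : ℕ) :
    m.choose x * m.choose (x + d + 1) ≤ m.choose (x + 1) * m.choose (x + d) := by
  have h1 : m.choose (x + 1) * (x + 1) = m.choose x * (m - x) := Nat.choose_succ_right_eq m x
  have h2 : m.choose (x + d + 1) * (x + d + 1) = m.choose (x + d) * (m - (x + d)) :=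
    Nat.choose_succ_right_eq m (x + d)
  have hpos : 0 < (x + 1) * (x + d + 1) := by positivity
  refine Nat.le_of_mul_le_mul_right ?_ hpos
  calc m.choose x * m.choose (x + d + 1) * ((x + 1) * (x + d + 1))
      = m.choose x * (m.choose (x + d + 1) * (x + d + 1)) * (x + 1) := by ring
    _ = m.choose x * m.choose (x + d) * ((x + 1) * (m - (x + d))) := by rw [h2]; ring
    _ ≤ m.choose x * m.choose (x + d) * ((x + d + 1) * (m - x)) := by
        refine Nat.mul_le_mul_left _ (Nat.mul_le_mul ?_ ?_)
        · omega
        · omega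
    _ = (m.choose x * (m - x)) * m.choose (x + d) * (x + d + 1) := by ring
    _ = (m.choose (x + 1) * (x + 1)) * m.choose (x + d) * (x + d + 1) := by rw [h1]
    _ = m.choose (x + 1) * m.choose (x + d) * ((x + 1) * (x + d + 1)) := by ring

/-- **A decrease propagates**: `Bq(u + 1) < Bp(u)` implies `Bq(u + 2) < Bp(u + 1)` (`q₂ ≤ p₂ ≤ u`,
`u + 1 ≤ |L| + q₂`, `|R| = p₂ + q₂`, `L`, `R` disjoint): the ratio `Bp(u)/Bq(u + 1)` is non-decreasing in `u`. -/
lemma bq_lt_bp_succ {L R : Finset α} (hLR : Disjoint L R) {q₂ p₂ u : ℕ} (hR : R.card = p₂ + q₂)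
    (hqp : q₂ ≤ p₂) (hpu : p₂ ≤ u) (huL : u + 1 ≤ L.card + q₂)
    (h : bqCount L R q₂ p₂ u < bpCount L R q₂ p₂ u) :
    bqCount L R q₂ p₂ (u + 1) < bpCount L R q₂ p₂ (u + 1) := by
  rw [bqCount_eq hLR hqp (by omega), bpCount_eq hLR hqp hpu] at h
  rw [bqCount_eq hLR hqp (by omega), bpCount_eq hLR hqp (by omega)]
  set m := L.card with hm
  have hlc := choose_mul_choose_le_choose_mul_choose_of_lt m (u - p₂) (p₂ - q₂ + 1)
  have e1 : u - p₂ + (p₂ - q₂ + 1) + 1 = u + 1 + 1 - q₂ := by omega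
  have e2 : u - p₂ + 1 = u + 1 - p₂ := by omega
  have e3 : u - p₂ + (p₂ - q₂ + 1) = u + 1 - q₂ := by omega
  rw [e1, e2, e3] at hlc
  -- `Bp(u)·Bq(u+2) ≤ Bp(u+1)·Bq(u+1)`
  have hprod : (m.choose (u - p₂) * R.card.choose p₂) * (m.choose (u + 1 + 1 - q₂) * R.card.choose q₂)
      ≤ (m.choose (u + 1 - p₂) * R.card.choose p₂) * (m.choose (u + 1 - q₂) * R.card.choose q₂) := by
    calc (m.choose (u - p₂) * R.card.choose p₂) * (m.choose (u + 1 + 1 - q₂) * R.card.choose q₂)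
        = (m.choose (u - p₂) * m.choose (u + 1 + 1 - q₂)) * (R.card.choose p₂ * R.card.choose q₂) := by ring
      _ ≤ (m.choose (u + 1 - p₂) * m.choose (u + 1 - q₂)) * (R.card.choose p₂ * R.card.choose q₂) :=
          Nat.mul_le_mul_right _ hlc
      _ = _ := by ring
  have hBq1pos : 0 < m.choose (u + 1 - q₂) * R.card.choose q₂ :=
    Nat.mul_pos (Nat.choose_pos (by omega)) (Nat.choose_pos (by omega))
  by_cases hBq2 : m.choose (u + 1 + 1 - q₂) * R.card.choose q₂ = 0
  · rw [hBq2]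
    exact Nat.mul_pos (Nat.choose_pos (by omega)) (Nat.choose_pos (by omega))
  · have hBq2pos : 0 < m.choose (u + 1 + 1 - q₂) * R.card.choose q₂ := Nat.pos_of_ne_zero hBq2
    by_contra hcon
    have hcon := not_lt.1 hcon
    -- `Bq(u+1)·Bq(u+2) < Bp(u)·Bq(u+2) ≤ Bp(u+1)·Bq(u+1) ≤ Bq(u+2)·Bq(u+1)`: contradiction
    have h1 : (m.choose (u + 1 - q₂) * R.card.choose q₂) * (m.choose (u + 1 + 1 - q₂) * R.card.choose q₂)
        < (m.choose (u - p₂) * R.card.choose p₂) * (m.choose (u + 1 + 1 - q₂) * R.card.choose q₂) :=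
      Nat.mul_lt_mul_of_pos_right h hBq2pos
    have h2 : (m.choose (u + 1 - p₂) * R.card.choose p₂) * (m.choose (u + 1 - q₂) * R.card.choose q₂)
        ≤ (m.choose (u + 1 + 1 - q₂) * R.card.choose q₂) * (m.choose (u + 1 - q₂) * R.card.choose q₂) :=
      Nat.mul_le_mul_right _ hcon
    have := (h1.trans_le hprod).trans_le h2
    rw [mul_comm (m.choose (u + 1 + 1 - q₂) * R.card.choose q₂)] at this
    exact lt_irrefl _ this

/-! ## The probability `π` and its unimodality on the middle regime -/

/-- `A·C(n, u + 1) ≤ B·C(n, u)` iff `A·(n − u) ≤ B·(u + 1)` (`u < n`): comparing `A/C(n, u)` with `B/C(n, u + 1)`. -/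
lemma mul_choose_succ_le_iff {n u A B : ℕ} (hu : u < n) :
    A * n.choose (u + 1) ≤ B * n.choose u ↔ A * (n - u) ≤ B * (u + 1) := by
  have h := Nat.choose_succ_right_eq n u
  have hpos : 0 < n.choose u := Nat.choose_pos hu.le
  constructor
  · intro hle
    refine Nat.le_of_mul_le_mul_right ?_ hpos
    calc A * (n - u) * n.choose u = A * (n.choose u * (n - u)) := by ring
      _ = A * (n.choose (u + 1) * (u + 1)) := by rw [h]
      _ = A * n.choose (u + 1) * (u + 1) := by ring
      _ ≤ B * n.choose u * (u + 1) := Nat.mul_le_mul_right _ hle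
      _ = B * (u + 1) * n.choose u := by ring
  · intro hle
    refine Nat.le_of_mul_le_mul_right ?_ (Nat.succ_pos u)
    calc A * n.choose (u + 1) * (u + 1) = A * (n.choose (u + 1) * (u + 1)) := by ring
      _ = A * (n.choose u * (n - u)) := by rw [h]
      _ = A * (n - u) * n.choose u := by ring
      _ ≤ B * (u + 1) * n.choose u := Nat.mul_le_mul_right _ hle
      _ = B * n.choose u * (u + 1) := by ring

/-- The probability that a uniform `u`-subset of `L ∪ R` lies in the one-sided family. -/
noncomputable def piR (L R : Finset α) (q₂ p₂ u : ℕ) : ℚ :=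
  ((rFam L R q₂ p₂ u).card : ℚ) / ((L ∪ R).card.choose u : ℚ)

/-- `π(u) ≤ π(u + 1)` iff `#rFam u · (n − u) ≤ #rFam (u + 1) · (u + 1)` (`u < n`). -/
lemma piR_le_succ_iff {L R : Finset α} {q₂ p₂ u : ℕ} (hu : u < (L ∪ R).card) :
    piR L R q₂ p₂ u ≤ piR L R q₂ p₂ (u + 1) ↔
      (rFam L R q₂ p₂ u).card * ((L ∪ R).card - u) ≤ (rFam L R q₂ p₂ (u + 1)).card * (u + 1) := by
  unfold piR
  rw [div_le_div_iff₀ (by exact_mod_cast Nat.choose_pos hu.le) (by exact_mod_cast Nat.choose_pos hu),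
    ← mul_choose_succ_le_iff hu]
  norm_cast

/-- `B·C(n, u) ≤ A·C(n, u + 1)` iff `B·(u + 1) ≤ A·(n − u)` (`u < n`). -/
lemma mul_choose_le_mul_choose_succ_iff {n u A B : ℕ} (hu : u < n) :
    B * n.choose u ≤ A * n.choose (u + 1) ↔ B * (u + 1) ≤ A * (n - u) := by
  have h := Nat.choose_succ_right_eq n u
  have hpos : 0 < n.choose u := Nat.choose_pos hu.le
  constructor
  · intro hle
    refine Nat.le_of_mul_le_mul_right ?_ hpos
    calc B * (u + 1) * n.choose u = B * n.choose u * (u + 1) := by ring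
      _ ≤ A * n.choose (u + 1) * (u + 1) := Nat.mul_le_mul_right _ hle
      _ = A * (n.choose (u + 1) * (u + 1)) := by ring
      _ = A * (n.choose u * (n - u)) := by rw [h]
      _ = A * (n - u) * n.choose u := by ring
  · intro hle
    refine Nat.le_of_mul_le_mul_right ?_ (Nat.succ_pos u)
    calc B * n.choose u * (u + 1) = B * (u + 1) * n.choose u := by ring
      _ ≤ A * (n - u) * n.choose u := Nat.mul_le_mul_right _ hle
      _ = A * (n.choose u * (n - u)) := by ring
      _ = A * (n.choose (u + 1) * (u + 1)) := by rw [h]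
      _ = A * n.choose (u + 1) * (u + 1) := by ring

/-- `π(u + 1) ≤ π(u)` iff `#rFam (u + 1) · (u + 1) ≤ #rFam u · (n − u)` (`u < n`). -/
lemma piR_succ_le_iff {L R : Finset α} {q₂ p₂ u : ℕ} (hu : u < (L ∪ R).card) :
    piR L R q₂ p₂ (u + 1) ≤ piR L R q₂ p₂ u ↔
      (rFam L R q₂ p₂ (u + 1)).card * (u + 1) ≤ (rFam L R q₂ p₂ u).card * ((L ∪ R).card - u) := by
  unfold piR
  rw [div_le_div_iff₀ (by exact_mod_cast Nat.choose_pos hu) (by exact_mod_cast Nat.choose_pos hu.le),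
    ← mul_choose_le_mul_choose_succ_iff hu]
  norm_cast

/-- **Going up**: `Bp(t) ≤ Bq(t + 1)` for every `a ≤ t < b` gives `π(a) ≤ π(b)` (`b ≤ n`, `|R| = p₂ + q₂`). -/
lemma piR_le_of_forall_bp_le_bq {L R : Finset α} (hLR : Disjoint L R) {q₂ p₂ : ℕ} (hR : R.card = p₂ + q₂)
    {a b : ℕ} (hab : a ≤ b) (hbn : b ≤ (L ∪ R).card)
    (h : ∀ t, a ≤ t → t < b → bpCount L R q₂ p₂ t ≤ bqCount L R q₂ p₂ t) :
    piR L R q₂ p₂ a ≤ piR L R q₂ p₂ b := by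
  induction b, hab using Nat.le_induction with
  | base => exact le_rfl
  | succ b hab ih =>
    refine (ih (by omega) (fun t hat htb => h t hat (by omega))).trans ?_
    rw [piR_le_succ_iff (by omega)]
    have hid := card_rFam_mul_add_eq hLR hR b
    have hbq := Nat.mul_le_mul_left q₂ (h b hab (by omega))
    omega

/-- **Going down**: `Bq(t + 1) < Bp(t)` for every `a ≤ t < b` gives `π(b) ≤ π(a)` (`b ≤ n`, `|R| = p₂ + q₂`). -/
lemma piR_le_of_forall_bq_lt_bp {L R : Finset α} (hLR : Disjoint L R) {q₂ p₂ : ℕ} (hR : R.card = p₂ + q₂)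
    {a b : ℕ} (hab : a ≤ b) (hbn : b ≤ (L ∪ R).card)
    (h : ∀ t, a ≤ t → t < b → bqCount L R q₂ p₂ t < bpCount L R q₂ p₂ t) :
    piR L R q₂ p₂ b ≤ piR L R q₂ p₂ a := by
  induction b, hab using Nat.le_induction with
  | base => exact le_rfl
  | succ b hab ih =>
    refine le_trans ?_ (ih (by omega) (fun t hat htb => h t hat (by omega)))
    rw [piR_succ_le_iff (by omega)]
    have hid := card_rFam_mul_add_eq hLR hR b
    have hbq := Nat.mul_le_mul_left q₂ (h b hab (by omega)).le
    omega

/-- **THE MIDDLE REGIME IS UNIMODAL**: `q₂ ≤ p₂ ≤ a ≤ u ≤ b ≤ min(n, |L| + q₂)`, `|R| = p₂ + q₂`, `L`, `R`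
disjoint — `min(π(a), π(b)) ≤ π(u)` for the one-sided family. -/
theorem piR_ge_min_of_middle {L R : Finset α} (hLR : Disjoint L R) {q₂ p₂ : ℕ} (hR : R.card = p₂ + q₂)
    (hqp : q₂ ≤ p₂) {a b u : ℕ} (hpa : p₂ ≤ a) (hbL : b ≤ L.card + q₂) (hbn : b ≤ (L ∪ R).card)
    (hau : a ≤ u) (hub : u ≤ b) : min (piR L R q₂ p₂ a) (piR L R q₂ p₂ b) ≤ piR L R q₂ p₂ u := by
  by_cases h : ∀ t, a ≤ t → t < u → bpCount L R q₂ p₂ t ≤ bqCount L R q₂ p₂ t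
  · exact (min_le_left _ _).trans (piR_le_of_forall_bp_le_bq hLR hR hau (hub.trans hbn) h)
  · obtain ⟨t, ht⟩ := not_forall.1 h
    obtain ⟨hat, ht'⟩ := Classical.not_imp.1 ht
    obtain ⟨htu, hlt⟩ := Classical.not_imp.1 ht'
    replace hlt := not_le.1 hlt
    -- the decrease propagates to every `t' ∈ [t, b)`
    have hprop : ∀ t', t ≤ t' → t' < b → bqCount L R q₂ p₂ t' < bpCount L R q₂ p₂ t' := by
      intro t' htt' ht'b
      induction t', htt' using Nat.le_induction with
      | base => exact hlt
      | succ t' htt' ih =>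
        exact bq_lt_bp_succ hLR hR hqp (by omega) (by omega) (ih (by omega))
    refine (min_le_right _ _).trans (piR_le_of_forall_bq_lt_bp hLR hR hub hbn ?_)
    intro t' hut' ht'b
    exact hprop t' (by omega) ht'b

end PercRepro.RankDist
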